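import Summits.Ventures.PercRepro.K5Matroid
import Summits.Ventures.PercRepro.K5LadderBase
import Summits.Ventures.PercRepro.K4LadderBridge
import Summits.Ventures.PercRepro.BlockSumBaseLayerFour

/-!
# PercRepro — C-025 on `T_p(M(K₅) ⊕ U_{m,m})`: the matroid bridge (p9, gen 15; local draft)

A rank-4 K-block family by the generic method: the block `M(K₅)` (`K5Matroid`) transported along any
`e : Fin 10 ↪ α`, its profile table (`(0,4)·1 (1,4)·10 (2,4)·55 (3,4)·230 (4,0)·1 (4,1)·10 (4,2)·55 (4,3)·230 (4,4)·432`), the base-layer inequality of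
`K5LadderBase` in profile form (`k5_profile_ineq`, every level `q ≥ 4`), and `rls_blockFree_of_baseLayer_four`
(the levels `q ≤ 3` by the tree's theorems for every matroid): **`rls_k5Ladder`** = C-025 on
`T_p(M(K₅) ⊕ U_{m,m})` for every level `q`, every `p ≥ q + 2` and every `m ≥ p + q − 4` (every corank
`≥ q + 2`). Nothing here is about any window of S4.
-/

namespace PercRepro.K5Ladder

open Set Finset PercRepro.LineLadder PercRepro.K4Ladder

/-- **The `K₅` inequality in profile form** at the base layer `m = p + q − 4`, every level `q ≥ 4`. -/
theorem k5_profile_ineq (p q : ℕ) (hq : 4 ≤ q) (hpq : q + 2 ≤ p) :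
    phiK p q * (((if 4 ≤ q then (p + q - 4).choose (q - 4) else 0) + 10 * (if 4 ≤ q then (p + q - 4).choose (q - 4) else 0)
        + 55 * (if 4 ≤ q then (p + q - 4).choose (q - 4) else 0)
        + 230 * (if 4 ≤ q then (p + q - 4).choose (q - 4) else 0)
        + (if 0 ≤ q then (p + q - 4).choose (q - 0) else 0)
        + 10 * (if 1 ≤ q then (p + q - 4).choose (q - 1) else 0)
        + 55 * (if 2 ≤ q then (p + q - 4).choose (q - 2) else 0)
        + 230 * (if 3 ≤ q then (p + q - 4).choose (q - 3) else 0)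
        + 432 * (if 4 ≤ q then (p + q - 4).choose (q - 4) else 0) : ℕ) : ℚ)
      ≤ ((∑ a ∈ Ico (q + 1) p, (p + q - 4).choose a + 10 * ∑ a ∈ Ico q (p - 1), (p + q - 4).choose a
        + 55 * ∑ a ∈ Ico (q - 1) (p - 2), (p + q - 4).choose a
        + 230 * ∑ a ∈ Ico (q - 2) (p - 3), (p + q - 4).choose a
        + ∑ a ∈ Ico (q - 3) (p - 4), (p + q - 4).choose a
        + 10 * ∑ a ∈ Ico (q - 3) (p - 4), (p + q - 4).choose a
        + 55 * ∑ a ∈ Ico (q - 3) (p - 4), (p + q - 4).choose a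
        + 230 * ∑ a ∈ Ico (q - 3) (p - 4), (p + q - 4).choose a
        + 432 * ∑ a ∈ Ico (q - 3) (p - 4), (p + q - 4).choose a : ℕ) : ℚ) := by
  obtain ⟨r, rfl⟩ : ∃ r, q = r + 4 := ⟨q - 4, by omega⟩
  obtain ⟨s, rfl⟩ : ∃ s, p = r + s + 6 := ⟨p - r - 6, by omega⟩
  have h := k5_base r s
  rw [if_pos (by omega : 4 ≤ r + 4), if_pos (by omega : 3 ≤ r + 4), if_pos (by omega : 2 ≤ r + 4),
    if_pos (by omega : 1 ≤ r + 4), if_pos (Nat.zero_le (r + 4)),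
    show r + s + 6 + (r + 4) - 4 = 2 * r + s + 6 by omega, Nat.sub_zero]
  have eU : ((2 * r + s + 6).choose (r + 4 - 4) + 10 * (2 * r + s + 6).choose (r + 4 - 4)
      + 55 * (2 * r + s + 6).choose (r + 4 - 4) + 230 * (2 * r + s + 6).choose (r + 4 - 4)
      + (2 * r + s + 6).choose (r + 4) + 10 * (2 * r + s + 6).choose (r + 4 - 1)
      + 55 * (2 * r + s + 6).choose (r + 4 - 2) + 230 * (2 * r + s + 6).choose (r + 4 - 3)
      + 432 * (2 * r + s + 6).choose (r + 4 - 4) : ℕ)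
      = 728 * (2 * r + s + 6).choose (r + 4 - 4) + 230 * (2 * r + s + 6).choose (r + 4 - 3)
        + 55 * (2 * r + s + 6).choose (r + 4 - 2) + 10 * (2 * r + s + 6).choose (r + 4 - 1)
        + (2 * r + s + 6).choose (r + 4) := by ring
  have eY : (∑ a ∈ Ico (r + 4 + 1) (r + s + 6), (2 * r + s + 6).choose a
      + 10 * ∑ a ∈ Ico (r + 4) (r + s + 6 - 1), (2 * r + s + 6).choose a
      + 55 * ∑ a ∈ Ico (r + 4 - 1) (r + s + 6 - 2), (2 * r + s + 6).choose a
      + 230 * ∑ a ∈ Ico (r + 4 - 2) (r + s + 6 - 3), (2 * r + s + 6).choose a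
      + ∑ a ∈ Ico (r + 4 - 3) (r + s + 6 - 4), (2 * r + s + 6).choose a
      + 10 * ∑ a ∈ Ico (r + 4 - 3) (r + s + 6 - 4), (2 * r + s + 6).choose a
      + 55 * ∑ a ∈ Ico (r + 4 - 3) (r + s + 6 - 4), (2 * r + s + 6).choose a
      + 230 * ∑ a ∈ Ico (r + 4 - 3) (r + s + 6 - 4), (2 * r + s + 6).choose a
      + 432 * ∑ a ∈ Ico (r + 4 - 3) (r + s + 6 - 4), (2 * r + s + 6).choose a : ℕ)
      = ∑ a ∈ Ico (r + 4 + 1) (r + s + 6), (2 * r + s + 6).choose a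
        + 10 * ∑ a ∈ Ico (r + 4) (r + s + 6 - 1), (2 * r + s + 6).choose a
        + 55 * ∑ a ∈ Ico (r + 4 - 1) (r + s + 6 - 2), (2 * r + s + 6).choose a
        + 230 * ∑ a ∈ Ico (r + 4 - 2) (r + s + 6 - 3), (2 * r + s + 6).choose a
        + 728 * ∑ a ∈ Ico (r + 4 - 3) (r + s + 6 - 4), (2 * r + s + 6).choose a := by ring
  rw [eU, eY]
  exact h

variable {α : Type}

/-- `M(K₅)` on any 10 points of `α` is finite. -/
theorem mapK5_finite (e : Fin 10 ↪ α) : (K5.mapEmbedding e).Finite :=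
  ⟨by rw [Matroid.mapEmbedding_ground_eq]; exact Set.finite_univ.image _⟩

/-- The ground set of the transported `M(K₅)` is the range of the embedding. -/
theorem mapK5_ground (e : Fin 10 ↪ α) : (K5.mapEmbedding e).E = Set.range e := by
  rw [Matroid.mapEmbedding_ground_eq, K5_ground, Set.image_univ]

/-- The rank function of the transported `M(K₅)` on the image of an edge set. -/
theorem mapK5_eRk (e : Fin 10 ↪ α) (X : Finset (Fin 10)) :
    (K5.mapEmbedding e).eRk (e '' (↑X : Set (Fin 10))) = (rk X : ℕ∞) := by
  rw [Matroid.mapEmbedding, Matroid.eRk_map K5 e.injective.injOn (Set.subset_univ _), eRk_coe]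

/-- The rank of the complement of the image of an edge set. -/
theorem mapK5_eRk_compl (e : Fin 10 ↪ α) (X : Finset (Fin 10)) :
    (K5.mapEmbedding e).eRk ((K5.mapEmbedding e).E \ e '' (↑X : Set (Fin 10))) = (rk Xᶜ : ℕ∞) := by
  rw [mapK5_ground, ← Set.image_univ, ← Set.image_sdiff e.injective, ← Set.compl_eq_univ_sdiff,
    ← Finset.coe_compl, mapK5_eRk]

/-- The subsets of the ground set of the transported `M(K₅)` are the images of the 1024 edge sets. -/
theorem finite_subsets_eq (e : Fin 10 ↪ α) :
    (mapK5_finite e).ground_finite.finite_subsets.toFinset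
      = (univ : Finset (Finset (Fin 10))).image (fun X : Finset (Fin 10) => e '' (↑X : Set (Fin 10))) := by
  ext T
  rw [Set.Finite.mem_toFinset, Set.mem_setOf_eq, Finset.mem_image, mapK5_ground]
  constructor
  · intro hT
    refine ⟨(Set.toFinite (e ⁻¹' T)).toFinset, Finset.mem_univ _, ?_⟩
    rw [Set.Finite.coe_toFinset, Set.image_preimage_eq_of_subset hT]
  · rintro ⟨X, -, rfl⟩
    exact Set.image_subset_range _ _

/-- `X ↦ e '' ↑X` is injective on edge sets. -/
theorem image_coe_injective (e : Fin 10 ↪ α) :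
    Function.Injective (fun X : Finset (Fin 10) => e '' (↑X : Set (Fin 10))) := fun _ _ h =>
  Finset.coe_injective ((Set.image_injective.2 e.injective) h)

/-- **C-025 ON `T_p(M(K₅) ⊕ U_{m,m})`** for `M(K₅)` on 10 points of `α`, `F` any finite set of `m`
further points, every level `q`, every `p ≥ q + 2` and every `m ≥ p + q − 4` (every corank `≥ q + 2`). -/
theorem rls_k5Ladder (e : Fin 10 ↪ α) {F : Set α} (hF : F.Finite)
    (hEF : Disjoint (K5.mapEmbedding e).E (Matroid.freeOn F).E) {m p q : ℕ} (hFm : F.ncard = m)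
    (hpq : q + 2 ≤ p) (hm : p + q - 4 ≤ m) :
    @ThmN.RLS α (@PercRepro.Matroid.truncate α ((K5.mapEmbedding e).disjointSum (Matroid.freeOn F) hEF)
        (@blockFree_finite α _ (mapK5_finite e) F hF hEF) p)
      (@PercRepro.Matroid.truncate_finite α _ (@blockFree_finite α _ (mapK5_finite e) F hF hEF) p) p q := by
  haveI := mapK5_finite e
  refine rls_blockFree_of_baseLayer_four (K5.mapEmbedding e) 4 ?_ ?_ q hF hEF p hpq (by omega)
  · intro X hX
    rw [mapK5_ground] at hX
    obtain ⟨X', rfl⟩ : ∃ X' : Finset (Fin 10), e '' (↑X' : Set (Fin 10)) = X :=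
      ⟨(Set.toFinite (e ⁻¹' X)).toFinset, by rw [Set.Finite.coe_toFinset, Set.image_preimage_eq_of_subset hX]⟩
    rw [mapK5_eRk, mapK5_eRk_compl]
    simp only [ENat.toNat_coe]
    exact four_le_rk_add_rk_compl X'
  · intro p q hq hpq
    rw [finite_subsets_eq, Finset.sum_image (fun _ _ _ _ h => image_coe_injective e h),
      Finset.sum_image (fun _ _ _ _ h => image_coe_injective e h)]
    simp only [mapK5_eRk, mapK5_eRk_compl, ENat.toNat_coe]
    show phiK p q * ((∑ x : Finset (Fin 10), orbU p q (p + q - 4) (profile x) : ℕ) : ℚ)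
      ≤ ((∑ x : Finset (Fin 10), orbY p q (p + q - 4) (profile x) : ℕ) : ℚ)
    rw [sum_profile (orbU p q (p + q - 4)), sum_profile (orbY p q (p + q - 4))]
    simp only [orbU, orbY]
    have hqp : q < p := by omega
    rw [orbit_sum_U p q (p + q - 4) 0 4 hqp (by omega),
      orbit_sum_U p q (p + q - 4) 1 4 hqp (by omega),
      orbit_sum_U p q (p + q - 4) 2 4 hqp (by omega),
      orbit_sum_U p q (p + q - 4) 3 4 hqp (by omega),
      orbit_sum_U p q (p + q - 4) 4 0 hqp (by omega),
      orbit_sum_U p q (p + q - 4) 4 1 hqp (by omega),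
      orbit_sum_U p q (p + q - 4) 4 2 hqp (by omega),
      orbit_sum_U p q (p + q - 4) 4 3 hqp (by omega),
      orbit_sum_U p q (p + q - 4) 4 4 hqp (by omega),
      orbit_sum_Y p q (p + q - 4) 0, orbit_sum_Y p q (p + q - 4) 1, orbit_sum_Y p q (p + q - 4) 2, orbit_sum_Y p q (p + q - 4) 3, orbit_sum_Y p q (p + q - 4) 4]
    rw [show q + 1 - 0 = q + 1 by omega, show p - 0 = p by omega, show q + 1 - 1 = q by omega,
      show q + 1 - 2 = q - 1 by omega, show q + 1 - 3 = q - 2 by omega, show q + 1 - 4 = q - 3 by omega]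
    exact k5_profile_ineq p q hq hpq

end PercRepro.K5Ladder
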